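import Mathlib
import Summits.NavierStokesRegularity.NavierStokesRegularity.Theorems.EulerZoomLiouvillePowerGaugeEulerLiouvilleSelfSimilarTransfer
import HarnessLib

/-!
# THE REVERSE GAUGE DICTIONARY: own-rate profile data ⇒ the three gauges of an exactly self-similar field about the origin
# (crux `EulerZoomLiouville.PowerGaugeEulerLiouville` = stmt-NavierStokesRegularity-19832; tools for the CENTRE/EXPONENT TRANSFER of
# past power clocks — line `logtime-breathers`, residue T4 «window clocks»)

Route `EulerZoomLiouville` (NavierStokesRegularity); width seat ns-ezl-w6 g2 (cell ns-regularity-ideate, LEAD ns-typeII-p2).  The lineage's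
dictionary (`…SelfSimilarGauges`, `…SelfSimilarPastProfileDissipation/Pressure`, …) reads the three Seregin gauges of a member IN PROFILE VARIABLES.
This file is the CONVERSE, for ANY rate: let `γ = 1/(2+ρ)` with `ρ < 1` (`γ > 1/3`), and let `u(τ) = selfSimilarCollapse γ 0 W τ`,
`H(τ) = (−τ)^{−1} • G((−τ)^{−γ} ·)` (a.e.), `p(τ) = selfSimilarCollapsePressure γ 0 Q τ` for `τ < 0`.  Then, at the space–time ORIGIN,

* `ClockTransfer.gaugeA_of_profile` — `∫_{B_L}‖W‖² ≤ N L^{1−2ρ}` for all `L > 0` ⇒ `a^{2ρ} A(a; 0; u) ≤ N` for all `a > 0`;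
* `ClockTransfer.gaugeE_of_profile` — `∫ |G|²_F ‖z‖^{ρ−1} dz ≤ M` ⇒ `a^{ρ} E(a; 0; H) ≤ ((2+ρ)/(1−ρ)) M` for all `a > 0`;
* `ClockTransfer.gaugeD_of_profile` — `∫ |Q|^{3/2} ‖z‖^{2ρ−2} dz ≤ M` ⇒ `a^{2ρ} D(a; 0; p) ≤ ((2+ρ)/(2(1−ρ))) M` for all `a > 0`.

The parabolic window `(−a², 0)` of the CKN cylinders is NOT invariant under the Euler scaling of exponent `2+ρ`; the mismatch is absorbed
exactly: with `σ = −τ`, `L = aσ^{−γ}` one has `a^{2ρ−1}σ^{5γ−2} = L^{2ρ−1}` (the `A`-part), and by Tonelli the inner time integrals are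
`∫_{σ < (a/‖z‖)^{1/γ}} σ^{3γ−2} dσ ≤ (a/‖z‖)^{3−1/γ}/(3γ−1)`, resp. `σ^{6γ−3}` and `(a/‖z‖)^{6−2/γ}/(6γ−2)` (the `E`- and `D`-parts),
whose `a`-powers cancel against `a^{ρ−1}`, resp. `a^{2ρ−2}` (`ClockTransfer.lintegral_Ioo_rpow_mul_ball_le` is the common Tonelli core).
USE (sequel `…ClockTransfer`): a class member whose velocity is an exact power clock of rate `g = 1/(2+ρ′)` about `(T, x₀)` with `T₁ = T ≤ 0`
carries these own-rate data (one origin cylinder contains the whole collapse), so its translate to `(T, x₀)` is a class-`ρ′` member exactly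
self-similar about the origin — the window `[2/5, 1/(2+ρ))` is THE ONE STATEMENT at `ρ′`.

WHAT THIS IS NOT: not NS, not E — pure measure-theoretic scaling lemmas on the MODEL lattice (strata of the crux CLASS 19832), `--supports`
stmt-19832; 19832 OPEN; NS regularity NOT proved. [folklore; ChaeShvydkoy2013 §1 (1.3)]
-/

noncomputable section

-- flat `Theorems/<Route><Decl>…` files of one crux share the namespace of the crux (tree convention: `Summit.<S>.<S>.…`)
set_option linter.dupNamespace false

open MeasureTheory Set Filter Topology Metric Function TopologicalSpace
open scoped ENNReal NNReal

namespace Summit.NavierStokesRegularity.NavierStokesRegularity.Theorems.PowerGaugeEulerLiouville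

open Literature.Analysis Literature.Analysis.FunctionSpaces Literature.Analysis.FluidPDE

namespace ClockTransfer

/-! ### The Tonelli core -/

/-- For `z ≠ 0`, `σ > 0`, `γ > 0`: `‖z‖ < σ^{−γ} a` forces `σ < (a/‖z‖)^{1/γ}`. [folklore] -/
theorem lt_rpow_of_norm_lt {γ σ a : ℝ} (hγ : 0 < γ) (hσ : 0 < σ)
    {z : EuclideanSpace ℝ (Fin 3)} (hz : z ≠ 0) (h : ‖z‖ < σ ^ (-γ) * a) :
    σ < (a / ‖z‖) ^ (1 / γ) := by
  have hz' : 0 < ‖z‖ := norm_pos_iff.2 hz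
  have hσγ : 0 < σ ^ γ := Real.rpow_pos_of_pos hσ _
  -- `σ^γ ‖z‖ < a`
  have h1 : σ ^ γ * ‖z‖ < a := by
    have := mul_lt_mul_of_pos_left h hσγ
    rwa [← mul_assoc, ← Real.rpow_add hσ, add_neg_cancel, Real.rpow_zero, one_mul] at this
  have h2 : σ ^ γ < a / ‖z‖ := by rwa [lt_div_iff₀ hz']
  calc σ = (σ ^ γ) ^ (1 / γ) := by
        rw [← Real.rpow_mul hσ.le, mul_one_div_cancel hγ.ne', Real.rpow_one]
    _ < (a / ‖z‖) ^ (1 / γ) := Real.rpow_lt_rpow hσγ.le h2 (one_div_pos.2 hγ)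

/-- **Tonelli core of the reverse dictionary** (parabolic time window `(−a², 0)`).  For `γ > 0`, `e > −1`, `a > 0` and
a.e.-measurable `f ≥ 0` on `ℝ³`:
`∫_{τ ∈ (−a², 0)} (−τ)^e ∫_{B(0, (−τ)^{−γ} a)} f dτ ≤ (a^{(e+1)/γ}/(e+1)) · ∫ f(z) ‖z‖^{−(e+1)/γ} dz`
(swap the integrals; for `z ≠ 0` the time section `{‖z‖ < (−τ)^{−γ} a}` lies in `(−(a/‖z‖)^{1/γ}, 0)`, on which
`∫ (−τ)^e = (a/‖z‖)^{(e+1)/γ}/(e+1)` by the tree's `lintegral_Ioo_neg_rpow`). [folklore] -/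
theorem lintegral_Ioo_rpow_mul_ball_le {γ e a : ℝ} (hγ : 0 < γ) (he : -1 < e) (ha : 0 < a)
    {f : EuclideanSpace ℝ (Fin 3) → ℝ≥0∞} (hf : AEMeasurable f volume) :
    ∫⁻ τ in Ioo (-(a ^ 2)) 0, ENNReal.ofReal ((-τ) ^ e) *
        ∫⁻ z in ball (0 : EuclideanSpace ℝ (Fin 3)) ((-τ) ^ (-γ) * a), f z ≤
      ENNReal.ofReal (a ^ ((e + 1) / γ) / (e + 1)) *
        ∫⁻ z, f z * ENNReal.ofReal (‖z‖ ^ (-((e + 1) / γ))) := by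
  have he1 : 0 < e + 1 := by linarith
  -- the joint integrand
  set S : Set (ℝ × EuclideanSpace ℝ (Fin 3)) := {q | ‖q.2‖ < (-q.1) ^ (-γ) * a} with hS
  have hSm : MeasurableSet S := by
    rw [hS]
    exact measurableSet_lt measurable_snd.norm ((measurable_fst.neg.pow_const _).mul_const a)
  set F : ℝ × EuclideanSpace ℝ (Fin 3) → ℝ≥0∞ :=
    fun q => S.indicator (fun q => ENNReal.ofReal ((-q.1) ^ e) * f q.2) q with hF
  have hFm : AEMeasurable F (((volume : Measure ℝ).restrict (Ioo (-(a ^ 2)) 0)).prod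
      (volume : Measure (EuclideanSpace ℝ (Fin 3)))) := by
    refine AEMeasurable.indicator ?_ hSm
    exact (measurable_fst.neg.pow_const _).ennreal_ofReal.aemeasurable.mul
      (hf.comp_quasiMeasurePreserving Measure.quasiMeasurePreserving_snd)
  -- (1) the left-hand side as an iterated integral of `F`
  have hL : ∫⁻ τ in Ioo (-(a ^ 2)) 0, ENNReal.ofReal ((-τ) ^ e) *
        ∫⁻ z in ball (0 : EuclideanSpace ℝ (Fin 3)) ((-τ) ^ (-γ) * a), f z =
      ∫⁻ τ in Ioo (-(a ^ 2)) 0, ∫⁻ z, F (τ, z) := by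
    refine lintegral_congr fun τ => ?_
    rw [← lintegral_indicator measurableSet_ball,
      ← lintegral_const_mul'' _ (hf.indicator measurableSet_ball)]
    refine lintegral_congr fun z => ?_
    rw [hF]
    simp only [hS, indicator, mem_setOf_eq, mem_ball_zero_iff]
    split_ifs <;> simp
  -- (2) swap
  have hswap : ∫⁻ τ in Ioo (-(a ^ 2)) 0, ∫⁻ z, F (τ, z) = ∫⁻ z, ∫⁻ τ in Ioo (-(a ^ 2)) 0, F (τ, z) :=
    lintegral_lintegral_swap hFm
  -- (3) the inner integral, `z ≠ 0`
  have hinner : ∀ z : EuclideanSpace ℝ (Fin 3), z ≠ 0 →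
      ∫⁻ τ in Ioo (-(a ^ 2)) 0, F (τ, z) ≤
        ENNReal.ofReal (a ^ ((e + 1) / γ) / (e + 1)) * (f z * ENNReal.ofReal (‖z‖ ^ (-((e + 1) / γ)))) := by
    intro z hz
    have hz' : 0 < ‖z‖ := norm_pos_iff.2 hz
    set b : ℝ := (a / ‖z‖) ^ (1 / γ) with hb
    have hb0 : 0 < b := Real.rpow_pos_of_pos (div_pos ha hz') _
    -- pointwise: `F(τ, z) ≤ 1_{(−b,0)}(τ) (−τ)^e f z` on `(−a², 0)`
    have hpt : ∀ τ ∈ Ioo (-(a ^ 2)) 0,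
        F (τ, z) ≤ (Ioo (-b) 0).indicator (fun τ => ENNReal.ofReal ((-τ) ^ e)) τ * f z := by
      intro τ hτ
      have hτ0 : 0 < -τ := neg_pos.2 hτ.2
      rw [hF]
      simp only [hS, indicator, mem_setOf_eq, mem_Ioo]
      split_ifs with h1 h2
      · exact le_rfl
      · exact absurd ⟨by linarith [lt_rpow_of_norm_lt hγ hτ0 hz h1], hτ.2⟩ h2
      · exact zero_le
      · exact zero_le
    have hbpow : b ^ (e + 1) = a ^ ((e + 1) / γ) * ‖z‖ ^ (-((e + 1) / γ)) := by
      rw [hb, ← Real.rpow_mul (div_nonneg ha.le hz'.le), one_div_mul_eq_div,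
        Real.div_rpow ha.le hz'.le, Real.rpow_neg hz'.le, div_eq_mul_inv]
    calc ∫⁻ τ in Ioo (-(a ^ 2)) 0, F (τ, z)
        ≤ ∫⁻ τ in Ioo (-(a ^ 2)) 0, (Ioo (-b) 0).indicator (fun τ => ENNReal.ofReal ((-τ) ^ e)) τ * f z :=
          setLIntegral_mono' measurableSet_Ioo hpt
      _ ≤ ∫⁻ τ, (Ioo (-b) 0).indicator (fun τ => ENNReal.ofReal ((-τ) ^ e)) τ * f z :=
          setLIntegral_le_lintegral _ _
      _ = (∫⁻ τ in Ioo (-b) 0, ENNReal.ofReal ((-τ) ^ e)) * f z := by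
          have hm : Measurable fun τ : ℝ => (Ioo (-b) 0).indicator (fun τ => ENNReal.ofReal ((-τ) ^ e)) τ :=
            ((measurable_id'.neg.pow_const e).ennreal_ofReal).indicator measurableSet_Ioo
          rw [lintegral_mul_const _ hm, lintegral_indicator measurableSet_Ioo]
      _ = ENNReal.ofReal (b ^ (e + 1) / (e + 1)) * f z := by rw [lintegral_Ioo_neg_rpow he hb0]
      _ = ENNReal.ofReal (a ^ ((e + 1) / γ) / (e + 1)) * (f z * ENNReal.ofReal (‖z‖ ^ (-((e + 1) / γ)))) := by
          rw [hbpow, mul_comm (f z), ← mul_assoc, ← ENNReal.ofReal_mul (by positivity)]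
          congr 2
          ring
  -- (4) assemble: `z ≠ 0` a.e.
  have hae : ∀ᵐ z ∂(volume : Measure (EuclideanSpace ℝ (Fin 3))), z ≠ 0 := by
    have h0 : ({0} : Set (EuclideanSpace ℝ (Fin 3)))ᶜ ∈ ae (volume : Measure (EuclideanSpace ℝ (Fin 3))) :=
      compl_mem_ae_iff.2 (measure_singleton 0)
    filter_upwards [h0] with z hz
    simpa using hz
  rw [hL, hswap]
  calc ∫⁻ z, ∫⁻ τ in Ioo (-(a ^ 2)) 0, F (τ, z)
      ≤ ∫⁻ z : EuclideanSpace ℝ (Fin 3), ENNReal.ofReal (a ^ ((e + 1) / γ) / (e + 1)) *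
          (f z * ENNReal.ofReal (‖z‖ ^ (-((e + 1) / γ)))) :=
        lintegral_mono_ae (hae.mono fun z hz => hinner z hz)
    _ = _ := lintegral_const_mul'' _
        (by exact hf.mul (measurable_norm.pow_const _).ennreal_ofReal.aemeasurable)

/-! ### The `A`-gauge from the normalised energy of the profile -/

/-- **`A`-GAUGE OF AN EXACTLY SELF-SIMILAR FIELD FROM ITS PROFILE** (`γ = 1/(2+ρ)`, any `ρ > −2`).  If
`u(τ) = selfSimilarCollapse γ 0 W τ` for `τ < 0` and `∫_{B_L}‖W‖² ≤ N L^{1−2ρ}` for EVERY `L > 0`, then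
`a^{2ρ} A(a; 0; u) ≤ N` for every `a > 0` — the converse of `profile_energy_growth_of_gaugeA` with the same constant (slice at time
`τ = −σ`, radius `a`, sees the profile ball of radius `L = σ^{−γ}a`, and `a^{2ρ−1}σ^{5γ−2}L^{1−2ρ} = 1` because `γ(2+ρ) = 1`). [folklore] -/
theorem gaugeA_of_profile {ρ : ℝ} (hρ : 0 < 2 + ρ)
    {u : ℝ → EuclideanSpace ℝ (Fin 3) → EuclideanSpace ℝ (Fin 3)}
    {W : EuclideanSpace ℝ (Fin 3) → EuclideanSpace ℝ (Fin 3)} {N : ℝ≥0}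
    (hu : ∀ τ : ℝ, τ < 0 → u τ = selfSimilarCollapse (1 / (2 + ρ)) 0 W τ)
    (hN : ∀ L : ℝ, 0 < L →
      ∫⁻ y in ball (0 : EuclideanSpace ℝ (Fin 3)) L, ‖W y‖ₑ ^ 2 ≤ (N : ℝ≥0∞) * ENNReal.ofReal (L ^ (1 - 2 * ρ))) :
    ∀ a : ℝ, 0 < a → ENNReal.ofReal (a ^ (2 * ρ)) * cknA a (0 : ℝ × EuclideanSpace ℝ (Fin 3)) u ≤ (N : ℝ≥0∞) := by
  intro a ha
  set γ : ℝ := 1 / (2 + ρ) with hγ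
  have hγρ : γ * (2 + ρ) = 1 := by rw [hγ]; field_simp
  unfold cknA
  rw [Prod.fst_zero, Prod.snd_zero, zero_sub, ENNReal.mul_iSup]
  refine iSup_le fun t => ?_
  rw [ENNReal.mul_iSup]
  refine iSup_le fun ht => ?_
  have ht0 : t < 0 := ht.2
  have hs : 0 < -t := neg_pos.2 ht0
  have hsγ : 0 < (-t) ^ (-γ) := Real.rpow_pos_of_pos hs _
  set L : ℝ := (-t) ^ (-γ) * a with hL
  have hL0 : 0 < L := mul_pos hsγ ha
  rw [hu t ht0, lintegral_ball_enorm_sq_selfSimilarCollapse γ ht0 W a]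
  -- the scalar bookkeeping
  have hscal : ENNReal.ofReal (a ^ (2 * ρ)) * (ENNReal.ofReal a)⁻¹ * ENNReal.ofReal ((-t) ^ (5 * γ - 2)) *
      ENNReal.ofReal (L ^ (1 - 2 * ρ)) = 1 := by
    rw [← ENNReal.ofReal_inv_of_pos ha, ← ENNReal.ofReal_mul (by positivity),
      ← ENNReal.ofReal_mul (by positivity), ← ENNReal.ofReal_mul (by positivity), ← ENNReal.ofReal_one]
    congr 1
    rw [hL, Real.mul_rpow hsγ.le ha.le, ← Real.rpow_mul hs.le]
    have ha1 : a ^ (2 * ρ) * a⁻¹ * a ^ (1 - 2 * ρ) = 1 := by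
      rw [mul_assoc, mul_comm a⁻¹, ← mul_assoc, ← Real.rpow_add ha,
        show 2 * ρ + (1 - 2 * ρ) = 1 by ring, Real.rpow_one, mul_inv_cancel₀ ha.ne']
    have hs1 : (-t) ^ (5 * γ - 2) * (-t) ^ (-γ * (1 - 2 * ρ)) = 1 := by
      rw [← Real.rpow_add hs, show 5 * γ - 2 + -γ * (1 - 2 * ρ) = 0 by linear_combination 2 * hγρ,
        Real.rpow_zero]
    calc a ^ (2 * ρ) * a⁻¹ * (-t) ^ (5 * γ - 2) * ((-t) ^ (-γ * (1 - 2 * ρ)) * a ^ (1 - 2 * ρ))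
        = (a ^ (2 * ρ) * a⁻¹ * a ^ (1 - 2 * ρ)) * ((-t) ^ (5 * γ - 2) * (-t) ^ (-γ * (1 - 2 * ρ))) := by ring
      _ = 1 := by rw [ha1, hs1, one_mul]
  calc ENNReal.ofReal (a ^ (2 * ρ)) * ((ENNReal.ofReal a)⁻¹ * (ENNReal.ofReal ((-t) ^ (5 * γ - 2)) *
          ∫⁻ y in ball (0 : EuclideanSpace ℝ (Fin 3)) L, ‖W y‖ₑ ^ 2))
      ≤ ENNReal.ofReal (a ^ (2 * ρ)) * ((ENNReal.ofReal a)⁻¹ * (ENNReal.ofReal ((-t) ^ (5 * γ - 2)) *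
          ((N : ℝ≥0∞) * ENNReal.ofReal (L ^ (1 - 2 * ρ))))) := by gcongr; exact hN L hL0
    _ = (N : ℝ≥0∞) * (ENNReal.ofReal (a ^ (2 * ρ)) * (ENNReal.ofReal a)⁻¹ * ENNReal.ofReal ((-t) ^ (5 * γ - 2)) *
          ENNReal.ofReal (L ^ (1 - 2 * ρ))) := by ring
    _ = (N : ℝ≥0∞) := by rw [hscal, mul_one]

/-! ### The `E`-gauge from the weighted dissipation of the profile -/

/-- **`E`-GAUGE OF A SELF-SIMILAR GRADIENT FROM ITS PROFILE WEIGHT** (`γ = 1/(2+ρ)`, `−2 < ρ < 1`).  If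
`H(τ) = (−τ)^{−1} • G((−τ)^{−γ} ·)` for `τ < 0` (pointwise; a.e. versions via `cknE_congr_ae_slab`) and
`∫ |G(z)|²_F ‖z‖^{ρ−1} dz ≤ M`, then `a^{ρ} E(a; 0; H) ≤ ((2+ρ)/(1−ρ)) M` for every `a > 0` — the converse of
`profile_gradient_weight_of_gaugeE` with the reciprocal constant. [folklore] -/
theorem gaugeE_of_profile {ρ : ℝ} (hρ : 0 < 2 + ρ) (hρ1 : ρ < 1)
    {H : ℝ → EuclideanSpace ℝ (Fin 3) → EuclideanSpace ℝ (Fin 3) →L[ℝ] EuclideanSpace ℝ (Fin 3)}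
    {G : EuclideanSpace ℝ (Fin 3) → EuclideanSpace ℝ (Fin 3) →L[ℝ] EuclideanSpace ℝ (Fin 3)}
    (hGm : AEStronglyMeasurable G volume)
    (hHm : AEStronglyMeasurable (uncurry H)
      (volume.restrict (Iio (0 : ℝ) ×ˢ (univ : Set (EuclideanSpace ℝ (Fin 3))))))
    (hH : ∀ τ : ℝ, τ < 0 → H τ = fun x => (-τ) ^ (-1 : ℝ) • G ((-τ) ^ (-(1 / (2 + ρ))) • x))
    {M : ℝ≥0∞} (hM : ∫⁻ z, ENNReal.ofReal (frobeniusNormSq (G z)) * ENNReal.ofReal (‖z‖ ^ (ρ - 1)) ≤ M) :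
    ∀ a : ℝ, 0 < a → ENNReal.ofReal (a ^ ρ) * cknE a (0 : ℝ × EuclideanSpace ℝ (Fin 3)) H ≤
      ENNReal.ofReal ((2 + ρ) / (1 - ρ)) * M := by
  intro a ha
  set γ : ℝ := 1 / (2 + ρ) with hγ
  have hγρ : γ * (2 + ρ) = 1 := by rw [hγ]; field_simp
  have hγ0 : 0 < γ := by rw [hγ]; positivity
  have hq : -1 < 3 * γ - 2 := by
    have : 1 / 3 < γ := by
      rw [hγ, div_lt_div_iff₀ (by norm_num) hρ]; linarith
    linarith
  have hfm : Measurable fun L : EuclideanSpace ℝ (Fin 3) →L[ℝ] EuclideanSpace ℝ (Fin 3) =>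
      ENNReal.ofReal (frobeniusNormSq L) :=
    (SereginZajaczkowski2007.continuous_frobeniusNormSq).measurable.ennreal_ofReal
  set g : EuclideanSpace ℝ (Fin 3) → ℝ≥0∞ := fun y => ENNReal.ofReal (frobeniusNormSq (G y)) with hg
  have hgm : AEMeasurable g volume := hfm.comp_aemeasurable hGm.aemeasurable
  -- (1) the cylinder integral as a time integral of profile ball integrals
  set X : ℝ≥0∞ := ∫⁻ q in parabolicCylinder a (0 : ℝ × EuclideanSpace ℝ (Fin 3)),
    ENNReal.ofReal (frobeniusNormSq (H q.1 q.2)) with hX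
  have hHmQ : AEMeasurable (fun q : ℝ × EuclideanSpace ℝ (Fin 3) =>
      ENNReal.ofReal (frobeniusNormSq (H q.1 q.2)))
      (((volume : Measure ℝ).restrict (Ioo (-(a ^ 2)) 0)).prod
        ((volume : Measure (EuclideanSpace ℝ (Fin 3))).restrict (ball 0 a))) := by
    have hsub : Ioo (-(a ^ 2)) 0 ×ˢ ball (0 : EuclideanSpace ℝ (Fin 3)) a ⊆
        Iio (0 : ℝ) ×ˢ (univ : Set (EuclideanSpace ℝ (Fin 3))) :=
      prod_mono (fun t ht => ht.2) (subset_univ _)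
    have := hfm.comp_aemeasurable (hHm.mono_measure (Measure.restrict_mono hsub le_rfl)).aemeasurable
    rwa [Measure.volume_eq_prod, ← Measure.prod_restrict] at this
  have hXeq : X = ∫⁻ τ in Ioo (-(a ^ 2)) 0, ENNReal.ofReal ((-τ) ^ (3 * γ - 2)) *
      ∫⁻ y in ball (0 : EuclideanSpace ℝ (Fin 3)) ((-τ) ^ (-γ) * a), g y := by
    rw [hX]
    unfold parabolicCylinder
    rw [Prod.fst_zero, Prod.snd_zero, zero_sub, Measure.volume_eq_prod, ← Measure.prod_restrict,
      lintegral_prod _ hHmQ]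
    refine setLIntegral_congr_fun measurableSet_Ioo fun τ hτ => ?_
    have key := lintegral_ball_frobeniusNormSq_selfSimilarGradient γ hτ.2 G a
    rw [show (fun x => ENNReal.ofReal (frobeniusNormSq ((-τ) ^ (-1 : ℝ) • G ((-τ) ^ (-γ) • x)))) =
      fun x => ENNReal.ofReal (frobeniusNormSq (H τ x)) by rw [hH τ hτ.2]] at key
    exact key
  -- (2) the Tonelli core and the exponent bookkeeping
  have hcore := lintegral_Ioo_rpow_mul_ball_le hγ0 hq ha hgm
  have h3γ : 3 * γ - 2 + 1 = (1 - ρ) / (2 + ρ) := by rw [hγ]; field_simp; ring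
  have hexp1 : (3 * γ - 2 + 1) / γ = 1 - ρ := by rw [hγ]; field_simp; ring
  have hw : (fun z : EuclideanSpace ℝ (Fin 3) => g z * ENNReal.ofReal (‖z‖ ^ (-((3 * γ - 2 + 1) / γ)))) =
      fun z => g z * ENNReal.ofReal (‖z‖ ^ (ρ - 1)) := by
    funext z; rw [hexp1, neg_sub]
  rw [hw, hexp1, h3γ] at hcore
  -- (3) the scalar bookkeeping `a^ρ a⁻¹ a^{1−ρ}/((1−ρ)/(2+ρ)) = (2+ρ)/(1−ρ)`
  have h1ρ : 0 < 1 - ρ := by linarith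
  have hsc : ENNReal.ofReal (a ^ ρ) * (ENNReal.ofReal a)⁻¹ * ENNReal.ofReal (a ^ (1 - ρ) / ((1 - ρ) / (2 + ρ))) =
      ENNReal.ofReal ((2 + ρ) / (1 - ρ)) := by
    rw [← ENNReal.ofReal_inv_of_pos ha, ← ENNReal.ofReal_mul (by positivity),
      ← ENNReal.ofReal_mul (by positivity)]
    congr 1
    have h1 : a ^ ρ * a ^ (1 - ρ) = a := by
      rw [← Real.rpow_add ha, show ρ + (1 - ρ) = 1 by ring, Real.rpow_one]
    calc a ^ ρ * a⁻¹ * (a ^ (1 - ρ) / ((1 - ρ) / (2 + ρ)))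
        = (a ^ ρ * a ^ (1 - ρ)) * a⁻¹ * ((2 + ρ) / (1 - ρ)) := by
          rw [div_div_eq_mul_div]; ring
      _ = (2 + ρ) / (1 - ρ) := by rw [h1, mul_inv_cancel₀ ha.ne', one_mul]
  -- (4) assemble
  unfold cknE
  rw [← hX]
  calc ENNReal.ofReal (a ^ ρ) * ((ENNReal.ofReal a)⁻¹ * X)
      ≤ ENNReal.ofReal (a ^ ρ) * ((ENNReal.ofReal a)⁻¹ *
          (ENNReal.ofReal (a ^ (1 - ρ) / ((1 - ρ) / (2 + ρ))) *
            ∫⁻ z, g z * ENNReal.ofReal (‖z‖ ^ (ρ - 1)))) := by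
        gcongr
        exact hXeq ▸ hcore
    _ ≤ ENNReal.ofReal (a ^ ρ) * ((ENNReal.ofReal a)⁻¹ *
          (ENNReal.ofReal (a ^ (1 - ρ) / ((1 - ρ) / (2 + ρ))) * M)) := by gcongr
    _ = ENNReal.ofReal (a ^ ρ) * (ENNReal.ofReal a)⁻¹ *
          ENNReal.ofReal (a ^ (1 - ρ) / ((1 - ρ) / (2 + ρ))) * M := by ring
    _ = ENNReal.ofReal ((2 + ρ) / (1 - ρ)) * M := by rw [hsc]

/-! ### The `D`-gauge from the weighted pressure integral of the profile -/

/-- **`D`-GAUGE OF A PRESSURE ANSATZ FROM ITS PROFILE WEIGHT** (`γ = 1/(2+ρ)`, `−2 < ρ < 1`).  If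
`p(τ) = selfSimilarCollapsePressure γ 0 Q τ` for `τ < 0` and `∫ |Q(z)|^{3/2} ‖z‖^{2ρ−2} dz ≤ M`, then
`a^{2ρ} D(a; 0; p) ≤ ((2+ρ)/(2−2ρ)) M` for every `a > 0` — the converse of `profile_pressure_weight_of_gaugeD` with the
reciprocal constant. [folklore] -/
theorem gaugeD_of_profile {ρ : ℝ} (hρ : 0 < 2 + ρ) (hρ1 : ρ < 1)
    {p : ℝ → EuclideanSpace ℝ (Fin 3) → ℝ} {Q : EuclideanSpace ℝ (Fin 3) → ℝ}
    (hQm : AEStronglyMeasurable Q volume)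
    (hpm : AEStronglyMeasurable (uncurry p)
      (volume.restrict (Iio (0 : ℝ) ×ˢ (univ : Set (EuclideanSpace ℝ (Fin 3))))))
    (hp : ∀ τ : ℝ, τ < 0 → p τ = selfSimilarCollapsePressure (1 / (2 + ρ)) 0 Q τ)
    {M : ℝ≥0∞} (hM : ∫⁻ z, ‖Q z‖ₑ ^ (3 / 2 : ℝ) * ENNReal.ofReal (‖z‖ ^ (2 * ρ - 2)) ≤ M) :
    ∀ a : ℝ, 0 < a → ENNReal.ofReal (a ^ (2 * ρ)) * cknD a (0 : ℝ × EuclideanSpace ℝ (Fin 3)) p ≤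
      ENNReal.ofReal ((2 + ρ) / (2 - 2 * ρ)) * M := by
  intro a ha
  set γ : ℝ := 1 / (2 + ρ) with hγ
  have hγρ : γ * (2 + ρ) = 1 := by rw [hγ]; field_simp
  have hγ0 : 0 < γ := by rw [hγ]; positivity
  have hq : -1 < 6 * γ - 3 := by
    have : 1 / 3 < γ := by
      rw [hγ, div_lt_div_iff₀ (by norm_num) hρ]; linarith
    linarith
  set g : EuclideanSpace ℝ (Fin 3) → ℝ≥0∞ := fun y => ‖Q y‖ₑ ^ (3 / 2 : ℝ) with hg
  have hgm : AEMeasurable g volume := hQm.aemeasurable.enorm.pow_const _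
  -- (1) the cylinder integral as a time integral of profile ball integrals
  set X : ℝ≥0∞ := ∫⁻ q in parabolicCylinder a (0 : ℝ × EuclideanSpace ℝ (Fin 3)),
    ‖p q.1 q.2‖ₑ ^ (3 / 2 : ℝ) with hX
  have hpmQ : AEMeasurable (fun q : ℝ × EuclideanSpace ℝ (Fin 3) => ‖p q.1 q.2‖ₑ ^ (3 / 2 : ℝ))
      (((volume : Measure ℝ).restrict (Ioo (-(a ^ 2)) 0)).prod
        ((volume : Measure (EuclideanSpace ℝ (Fin 3))).restrict (ball 0 a))) := by
    have hsub : Ioo (-(a ^ 2)) 0 ×ˢ ball (0 : EuclideanSpace ℝ (Fin 3)) a ⊆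
        Iio (0 : ℝ) ×ˢ (univ : Set (EuclideanSpace ℝ (Fin 3))) :=
      prod_mono (fun t ht => ht.2) (subset_univ _)
    have := (hpm.mono_measure (Measure.restrict_mono hsub le_rfl)).enorm.pow_const (3 / 2 : ℝ)
    rwa [Measure.volume_eq_prod, ← Measure.prod_restrict] at this
  have hXeq : X = ∫⁻ τ in Ioo (-(a ^ 2)) 0, ENNReal.ofReal ((-τ) ^ (6 * γ - 3)) *
      ∫⁻ y in ball (0 : EuclideanSpace ℝ (Fin 3)) ((-τ) ^ (-γ) * a), g y := by
    rw [hX]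
    unfold parabolicCylinder
    rw [Prod.fst_zero, Prod.snd_zero, zero_sub, Measure.volume_eq_prod, ← Measure.prod_restrict,
      lintegral_prod _ hpmQ]
    refine setLIntegral_congr_fun measurableSet_Ioo fun τ hτ => ?_
    have key := lintegral_ball_enorm_rpow_selfSimilarCollapsePressure γ hτ.2 Q a
    rw [← hp τ hτ.2] at key
    exact key
  -- (2) the Tonelli core and the exponent bookkeeping
  have hcore := lintegral_Ioo_rpow_mul_ball_le hγ0 hq ha hgm
  have h6γ : 6 * γ - 3 + 1 = (2 - 2 * ρ) / (2 + ρ) := by rw [hγ]; field_simp; ring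
  have hexp1 : (6 * γ - 3 + 1) / γ = 2 - 2 * ρ := by rw [hγ]; field_simp; ring
  have hw : (fun z : EuclideanSpace ℝ (Fin 3) => g z * ENNReal.ofReal (‖z‖ ^ (-((6 * γ - 3 + 1) / γ)))) =
      fun z => g z * ENNReal.ofReal (‖z‖ ^ (2 * ρ - 2)) := by
    funext z; rw [hexp1, neg_sub]
  rw [hw, hexp1, h6γ] at hcore
  -- (3) the scalar bookkeeping `a^{2ρ} (a²)⁻¹ a^{2−2ρ}/((2−2ρ)/(2+ρ)) = (2+ρ)/(2−2ρ)`
  have h1ρ : 0 < 2 - 2 * ρ := by linarith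
  have hsc : ENNReal.ofReal (a ^ (2 * ρ)) * (ENNReal.ofReal a ^ 2)⁻¹ *
      ENNReal.ofReal (a ^ (2 - 2 * ρ) / ((2 - 2 * ρ) / (2 + ρ))) = ENNReal.ofReal ((2 + ρ) / (2 - 2 * ρ)) := by
    rw [← ENNReal.ofReal_pow ha.le, ← ENNReal.ofReal_inv_of_pos (by positivity),
      ← ENNReal.ofReal_mul (by positivity), ← ENNReal.ofReal_mul (by positivity)]
    congr 1
    have h1 : a ^ (2 * ρ) * a ^ (2 - 2 * ρ) = a ^ 2 := by
      rw [← Real.rpow_add ha, show 2 * ρ + (2 - 2 * ρ) = (2 : ℝ) by ring, Real.rpow_two]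
    have ha2 : a ^ 2 ≠ 0 := pow_ne_zero _ ha.ne'
    calc a ^ (2 * ρ) * (a ^ 2)⁻¹ * (a ^ (2 - 2 * ρ) / ((2 - 2 * ρ) / (2 + ρ)))
        = (a ^ (2 * ρ) * a ^ (2 - 2 * ρ)) * (a ^ 2)⁻¹ * ((2 + ρ) / (2 - 2 * ρ)) := by
          rw [div_div_eq_mul_div]; ring
      _ = (2 + ρ) / (2 - 2 * ρ) := by rw [h1, mul_inv_cancel₀ ha2, one_mul]
  -- (4) assemble
  unfold cknD
  rw [← hX]
  calc ENNReal.ofReal (a ^ (2 * ρ)) * ((ENNReal.ofReal a ^ 2)⁻¹ * X)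
      ≤ ENNReal.ofReal (a ^ (2 * ρ)) * ((ENNReal.ofReal a ^ 2)⁻¹ *
          (ENNReal.ofReal (a ^ (2 - 2 * ρ) / ((2 - 2 * ρ) / (2 + ρ))) *
            ∫⁻ z, g z * ENNReal.ofReal (‖z‖ ^ (2 * ρ - 2)))) := by
        gcongr
        exact hXeq ▸ hcore
    _ ≤ ENNReal.ofReal (a ^ (2 * ρ)) * ((ENNReal.ofReal a ^ 2)⁻¹ *
          (ENNReal.ofReal (a ^ (2 - 2 * ρ) / ((2 - 2 * ρ) / (2 + ρ))) * M)) := by gcongr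
    _ = ENNReal.ofReal (a ^ (2 * ρ)) * (ENNReal.ofReal a ^ 2)⁻¹ *
          ENNReal.ofReal (a ^ (2 - 2 * ρ) / ((2 - 2 * ρ) / (2 + ρ))) * M := by ring
    _ = ENNReal.ofReal ((2 + ρ) / (2 - 2 * ρ)) * M := by rw [hsc]

end ClockTransfer

end Summit.NavierStokesRegularity.NavierStokesRegularity.Theorems.PowerGaugeEulerLiouville
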